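import Literature.Analysis.FluidPDE.BiotSavartBounds
import Literature.Analysis.FluidPDE.SingularKernelTruncation
import Literature.Analysis.FluidPDE.NewtonPotentialHolder
import HarnessLib

/-!
# The depleted stretching kernel `min(1, |z|/ρ) |z|⁻³` is bounded from `L⁶ ∩ L²` to `L^∞`

Analysis/FluidPDE proof file (theorems only), a brick of the discharge of
`Literature.Analysis.FluidPDE.constantin_fefferman` (`NSVorticity.lean`). Under
Constantin–Fefferman's hypothesis `|sin φ| ≤ |x − y|/ρ` the singular kernel `|x − y|⁻³` of the
stretching rate is depleted to `k_ρ(z) = min(1, |z|/ρ) |z|⁻³` (`VorticityDirectionDepletion.lean`),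
which is `ρ⁻¹|z|⁻²` near the origin and `|z|⁻³` at infinity, hence lies in `L^{6/5}` near `0` and
in `L²` away from `0`. By Hölder's inequality the convolution `k_ρ ∗ g` is bounded for
`g ∈ L⁶ ∩ L²`, uniformly in the point:

* `exists_integral_depletedKernel_le` — for `ρ > 0` there are `c₁, c₂ ≥ 0` with
  `∫ min(1, |x−y|/ρ) |x−y|⁻³ g(y) dy ≤ c₁ ‖g‖_{L⁶} + c₂ ‖g‖_{L²}` for every nonnegative
  `g ∈ L⁶ ∩ L²` and every `x` (Lemarié-Rieusset 2016, proof of Thm. 11.7, the step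
  "`|𝒜(t,x,y,x−y)| ≤ C |y|^{-5/2} M_R(t)`, and thus … `≤ C ‖ω‖₃² ‖ℐ_{1/2} ω‖₃ M_R(t)`" — the Riesz
  potential bound, here in the cruder `L⁶ × L^{6/5}` / `L² × L²` form which suffices with the
  Sobolev inequality `‖ω‖₆ ≲ ‖∇ω‖₂`).

The constants are `c₁ = ‖ρ⁻¹ 1_{|z|<ρ} |z|⁻²‖_{L^{6/5}}` and `c₂ = ‖1_{|z|≥ρ} |z|⁻³‖_{L²}` (finite by
the tree's radial integrability lemmas `integrable_holderMajorant`,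
`integrableOn_compl_ball_norm_rpow_neg`).

## References

* P. Constantin, C. Fefferman, Indiana Univ. Math. J. 42 (1993), §2. [ConstantinFeffermanIndiana1993]
* P. G. Lemarié-Rieusset, *The Navier–Stokes Problem in the 21st Century* (2016), Thm. 11.7
  (proof, PDF p. 371). [LemarieRieusset2016]
-/

noncomputable section

open MeasureTheory Set Function Filter Metric Real
open _root_.Topology
open scoped ENNReal NNReal

namespace Literature.Analysis.FluidPDE

/-! ### Pointwise splitting of the depleted kernel -/

/-- `min(1, |z|/ρ) |z|⁻³ = ρ⁻¹ 1_{|z|<ρ} |z|⁻² + 1_{|z|≥ρ} |z|⁻³` (also at `z = 0`, where all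
terms are the junk value `0`). [folklore] -/
theorem depletedKernel_eq_near_add_far {ρ : ℝ} (hρ : 0 < ρ) (z : (EuclideanSpace ℝ (Fin 3))) :
    min 1 (‖z‖ / ρ) * (‖z‖ ^ 3)⁻¹ =
      ρ⁻¹ * kernelMajorant ρ z + (ball (0 : (EuclideanSpace ℝ (Fin 3))) ρ)ᶜ.indicator (fun z => (‖z‖ ^ 3)⁻¹) z := by
  by_cases hz : ‖z‖ < ρ
  · have hmem : z ∈ ball (0 : (EuclideanSpace ℝ (Fin 3))) ρ := mem_ball_zero_iff.2 hz
    have hnot : z ∉ (ball (0 : (EuclideanSpace ℝ (Fin 3))) ρ)ᶜ := fun h => h hmem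
    rw [kernelMajorant, indicator_of_mem hmem, indicator_of_notMem hnot, add_zero]
    have hmin : min 1 (‖z‖ / ρ) = ‖z‖ / ρ := min_eq_right ((div_le_one hρ).2 hz.le)
    rw [hmin]
    rcases eq_or_lt_of_le (norm_nonneg z) with h0 | h0
    · rw [← h0]; simp
    · field_simp
  · have hmem : z ∈ (ball (0 : (EuclideanSpace ℝ (Fin 3))) ρ)ᶜ := fun h => hz (mem_ball_zero_iff.1 h)
    have hnot : z ∉ ball (0 : (EuclideanSpace ℝ (Fin 3))) ρ := fun h => hz (mem_ball_zero_iff.1 h)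
    rw [kernelMajorant, indicator_of_notMem hnot, indicator_of_mem hmem, mul_zero, zero_add]
    have hmin : min 1 (‖z‖ / ρ) = 1 := min_eq_left ((one_le_div hρ).2 (not_lt.1 hz))
    rw [hmin, one_mul]

/-- The depleted kernel is nonnegative. [folklore] -/
theorem depletedKernel_nonneg (ρ : ℝ) (hρ : 0 ≤ ρ) (z : (EuclideanSpace ℝ (Fin 3))) : 0 ≤ min 1 (‖z‖ / ρ) * (‖z‖ ^ 3)⁻¹ :=
  mul_nonneg (le_min zero_le_one (div_nonneg (norm_nonneg _) hρ)) (by positivity)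

/-! ### Integrability of the two pieces in `L^{6/5}` and `L²` -/

/-- `(ρ⁻¹ 1_{|z|<ρ}|z|⁻²)^{6/5} = ρ^{-6/5} 1_{|z|<ρ} |z|^{3/5 − 3}`. [folklore] -/
theorem nearKernel_rpow_eq {ρ : ℝ} (hρ : 0 < ρ) (z : (EuclideanSpace ℝ (Fin 3))) :
    (ρ⁻¹ * kernelMajorant ρ z) ^ (6 / 5 : ℝ) = ρ⁻¹ ^ (6 / 5 : ℝ) * holderMajorant (3 / 5) ρ z := by
  rw [Real.mul_rpow (by positivity) (kernelMajorant_nonneg ρ z)]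
  congr 1
  unfold kernelMajorant holderMajorant
  by_cases hz : z ∈ ball (0 : (EuclideanSpace ℝ (Fin 3))) ρ
  · rw [indicator_of_mem hz, indicator_of_mem hz]
    rcases eq_or_lt_of_le (norm_nonneg z) with h0 | h0
    · rw [← h0]; norm_num
    · rw [← Real.rpow_natCast, ← Real.rpow_neg (norm_nonneg z), ← Real.rpow_mul (norm_nonneg z)]
      norm_num
  · rw [indicator_of_notMem hz, indicator_of_notMem hz, Real.zero_rpow (by norm_num)]

/-- The near piece lies in `L^{6/5}`. [folklore] -/
theorem memLp_nearKernel {ρ : ℝ} (hρ : 0 < ρ) :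
    MemLp (fun z : (EuclideanSpace ℝ (Fin 3)) => ρ⁻¹ * kernelMajorant ρ z) (ENNReal.ofReal (6 / 5)) volume := by
  have hmeas : AEStronglyMeasurable (fun z : (EuclideanSpace ℝ (Fin 3)) => ρ⁻¹ * kernelMajorant ρ z) volume :=
    (measurable_const.mul (measurable_kernelMajorant ρ)).aestronglyMeasurable
  rw [← integrable_norm_rpow_iff hmeas (by norm_num) ENNReal.ofReal_ne_top,
    ENNReal.toReal_ofReal (by norm_num)]
  have heq : (fun z : (EuclideanSpace ℝ (Fin 3)) => ‖ρ⁻¹ * kernelMajorant ρ z‖ ^ (6 / 5 : ℝ)) =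
      fun z => ρ⁻¹ ^ (6 / 5 : ℝ) * holderMajorant (3 / 5) ρ z := by
    funext z
    rw [Real.norm_of_nonneg (mul_nonneg (by positivity) (kernelMajorant_nonneg ρ z)),
      nearKernel_rpow_eq hρ]
  rw [heq]
  exact (integrable_holderMajorant (by norm_num) ρ).const_mul _

/-- The far piece lies in `L²` (`|z|⁻⁶` is integrable off balls). [folklore] -/
theorem memLp_farKernel {ρ : ℝ} (hρ : 0 < ρ) :
    MemLp (fun z : (EuclideanSpace ℝ (Fin 3)) => (ball (0 : (EuclideanSpace ℝ (Fin 3))) ρ)ᶜ.indicator (fun z => (‖z‖ ^ 3)⁻¹) z)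
      (ENNReal.ofReal 2) volume := by
  have hmeas : AEStronglyMeasurable
      (fun z : (EuclideanSpace ℝ (Fin 3)) => (ball (0 : (EuclideanSpace ℝ (Fin 3))) ρ)ᶜ.indicator (fun z => (‖z‖ ^ 3)⁻¹) z) volume :=
    (Measurable.indicator (measurable_norm.pow_const 3).inv measurableSet_ball.compl).aestronglyMeasurable
  rw [← integrable_norm_rpow_iff hmeas (by norm_num) ENNReal.ofReal_ne_top,
    ENNReal.toReal_ofReal (by norm_num)]
  have heq : (fun z : (EuclideanSpace ℝ (Fin 3)) => ‖(ball (0 : (EuclideanSpace ℝ (Fin 3))) ρ)ᶜ.indicator (fun z => (‖z‖ ^ 3)⁻¹) z‖ ^ (2 : ℝ)) =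
      (ball (0 : (EuclideanSpace ℝ (Fin 3))) ρ)ᶜ.indicator fun z => ‖z‖ ^ (-(6 : ℝ)) := by
    funext z
    by_cases hz : z ∈ (ball (0 : (EuclideanSpace ℝ (Fin 3))) ρ)ᶜ
    · rw [indicator_of_mem hz, indicator_of_mem hz, Real.norm_of_nonneg (by positivity),
        ← Real.rpow_natCast, ← Real.rpow_neg (norm_nonneg z), ← Real.rpow_mul (norm_nonneg z)]
      norm_num
    · rw [indicator_of_notMem hz, indicator_of_notMem hz, norm_zero, Real.zero_rpow (by norm_num)]
  rw [heq, integrable_indicator_iff measurableSet_ball.compl]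
  exact NewtonPotentialHolder.integrableOn_compl_ball_norm_rpow_neg (by norm_num) hρ

/-! ### Hölder for a convolution at a point -/

/-- **Hölder's inequality for `∫ k(x − y) g(y) dy`**: for nonnegative `k ∈ L^p`, `g ∈ L^q`,
`p, q` conjugate, `∫ k(x−y) g(y) dy ≤ ‖k‖_p ‖g‖_q` (translation and reflection invariance of
Lebesgue measure and Mathlib's Hölder inequality). [folklore] -/
theorem integral_mul_comp_sub_le {p q : ℝ} (hpq : p.HolderConjugate q) {k g : (EuclideanSpace ℝ (Fin 3)) → ℝ}
    (hk0 : ∀ z, 0 ≤ k z) (hg0 : ∀ y, 0 ≤ g y) (hk : MemLp k (ENNReal.ofReal p) volume)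
    (hg : MemLp g (ENNReal.ofReal q) volume) (x : (EuclideanSpace ℝ (Fin 3))) :
    ∫ y, k (x - y) * g y ≤ (∫ z, k z ^ p) ^ (1 / p) * (∫ y, g y ^ q) ^ (1 / q) := by
  have hkx : MemLp (fun y => k (x - y)) (ENNReal.ofReal p) volume :=
    hk.comp_measurePreserving (Measure.measurePreserving_sub_left volume x)
  have h := integral_mul_le_Lp_mul_Lq_of_nonneg hpq (Eventually.of_forall fun y => hk0 (x - y))
    (Eventually.of_forall hg0) hkx hg
  rwa [integral_sub_left_eq_self (fun z => k z ^ p) volume x] at h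

/-- `‖g‖_{L^q}` as the `q`-th root of `∫ g^q` for nonnegative `g ∈ L^q` (`1 ≤ q < ∞`). [folklore] -/
theorem rpow_integral_rpow_eq_toReal_eLpNorm {q : ℝ} (hq : 0 < q) {g : (EuclideanSpace ℝ (Fin 3)) → ℝ} (hg0 : ∀ y, 0 ≤ g y)
    (hg : MemLp g (ENNReal.ofReal q) volume) :
    (∫ y, g y ^ q) ^ (1 / q) = (eLpNorm g (ENNReal.ofReal q) volume).toReal := by
  rw [MemLp.eLpNorm_eq_integral_rpow_norm (by simp [hq]) ENNReal.ofReal_ne_top hg,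
    ENNReal.toReal_ofReal (by positivity), ENNReal.toReal_ofReal hq.le, one_div]
  congr 1
  exact integral_congr_ae (Eventually.of_forall fun y => by simp [Real.norm_of_nonneg (hg0 y)])

/-! ### The sup bound -/

/-- **The depleted kernel maps `L⁶ ∩ L²` to `L^∞`, uniformly in the point** (the Riesz-potential
step of Lemarié-Rieusset 2016, proof of Thm. 11.7, in `L⁶ × L^{6/5}` / `L² × L²` form): for
`ρ > 0` there are `c₁, c₂ ≥ 0` such that for every nonnegative `g ∈ L⁶ ∩ L²` and every `x` at which
`y ↦ min(1, |x−y|/ρ) |x−y|⁻³ g(y)` is integrable,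
`∫ min(1, |x−y|/ρ) |x−y|⁻³ g(y) dy ≤ c₁ ‖g‖_{L⁶} + c₂ ‖g‖_{L²}`. [cite: LemarieRieusset2016, Thm. 11.7 (proof, PDF p. 371: the bound by ‖ℐ_{1/2}ω‖)] -/
theorem exists_integral_depletedKernel_le {ρ : ℝ} (hρ : 0 < ρ) :
    ∃ c₁ c₂ : ℝ, 0 ≤ c₁ ∧ 0 ≤ c₂ ∧ ∀ ⦃g : (EuclideanSpace ℝ (Fin 3)) → ℝ⦄, (∀ y, 0 ≤ g y) →
      MemLp g 6 volume → MemLp g 2 volume → ∀ x : (EuclideanSpace ℝ (Fin 3)),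
      Integrable (fun y => min 1 (‖x - y‖ / ρ) * (‖x - y‖ ^ 3)⁻¹ * g y) →
      ∫ y, min 1 (‖x - y‖ / ρ) * (‖x - y‖ ^ 3)⁻¹ * g y ≤
        c₁ * (eLpNorm g 6 volume).toReal + c₂ * (eLpNorm g 2 volume).toReal := by
  set kn : (EuclideanSpace ℝ (Fin 3)) → ℝ := fun z => ρ⁻¹ * kernelMajorant ρ z with hkn
  set kf : (EuclideanSpace ℝ (Fin 3)) → ℝ := fun z => (ball (0 : (EuclideanSpace ℝ (Fin 3))) ρ)ᶜ.indicator (fun z => (‖z‖ ^ 3)⁻¹) z with hkf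
  have hkn0 : ∀ z, 0 ≤ kn z := fun z => mul_nonneg (by positivity) (kernelMajorant_nonneg ρ z)
  have hkf0 : ∀ z, 0 ≤ kf z := fun z => by
    rw [hkf]; exact indicator_nonneg (fun _ _ => by positivity) z
  have hknm : Measurable kn := measurable_const.mul (measurable_kernelMajorant ρ)
  have hkfm : Measurable kf :=
    Measurable.indicator (measurable_norm.pow_const 3).inv measurableSet_ball.compl
  refine ⟨(∫ z, kn z ^ (6 / 5 : ℝ)) ^ (1 / (6 / 5 : ℝ)), (∫ z, kf z ^ (2 : ℝ)) ^ (1 / (2 : ℝ)),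
    Real.rpow_nonneg (integral_nonneg fun z => Real.rpow_nonneg (hkn0 z) _) _,
    Real.rpow_nonneg (integral_nonneg fun z => Real.rpow_nonneg (hkf0 z) _) _, ?_⟩
  intro g hg0 hg6 hg2 x hint
  have hgm : AEStronglyMeasurable g volume := hg2.1
  -- Hölder exponents
  have h65 : (6 / 5 : ℝ).HolderConjugate 6 := by
    rw [Real.holderConjugate_iff]; norm_num
  have h22 : (2 : ℝ).HolderConjugate 2 := Real.HolderConjugate.two_two
  have hg6' : MemLp g (ENNReal.ofReal 6) volume := by
    rwa [show ENNReal.ofReal 6 = (6 : ℝ≥0∞) by norm_num]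
  have hg2' : MemLp g (ENNReal.ofReal 2) volume := by
    rwa [show ENNReal.ofReal 2 = (2 : ℝ≥0∞) by norm_num]
  -- the two pieces are integrable (dominated by the integrable whole)
  have hsplit : ∀ y, min 1 (‖x - y‖ / ρ) * (‖x - y‖ ^ 3)⁻¹ * g y =
      kn (x - y) * g y + kf (x - y) * g y := fun y => by
    rw [← add_mul, depletedKernel_eq_near_add_far hρ (x - y)]
  have hin : Integrable (fun y => kn (x - y) * g y) := by
    refine ⟨((hknm.comp (measurable_const.sub measurable_id)).aestronglyMeasurable.mul hgm), ?_⟩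
    refine (hint.hasFiniteIntegral.mono (Eventually.of_forall fun y => ?_))
    rw [Real.norm_of_nonneg (mul_nonneg (hkn0 _) (hg0 y)),
      Real.norm_of_nonneg (mul_nonneg (depletedKernel_nonneg ρ hρ.le _) (hg0 y)), hsplit y]
    exact le_add_of_nonneg_right (mul_nonneg (hkf0 _) (hg0 y))
  have hif : Integrable (fun y => kf (x - y) * g y) := by
    refine ⟨((hkfm.comp (measurable_const.sub measurable_id)).aestronglyMeasurable.mul hgm), ?_⟩
    refine (hint.hasFiniteIntegral.mono (Eventually.of_forall fun y => ?_))
    rw [Real.norm_of_nonneg (mul_nonneg (hkf0 _) (hg0 y)),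
      Real.norm_of_nonneg (mul_nonneg (depletedKernel_nonneg ρ hρ.le _) (hg0 y)), hsplit y]
    exact le_add_of_nonneg_left (mul_nonneg (hkn0 _) (hg0 y))
  -- Hölder on each piece
  have hnear : ∫ y, kn (x - y) * g y ≤
      (∫ z, kn z ^ (6 / 5 : ℝ)) ^ (1 / (6 / 5 : ℝ)) * (eLpNorm g 6 volume).toReal := by
    have h := integral_mul_comp_sub_le h65 hkn0 hg0 (memLp_nearKernel hρ) hg6' x
    rw [rpow_integral_rpow_eq_toReal_eLpNorm (by norm_num) hg0 hg6',
      show ENNReal.ofReal 6 = (6 : ℝ≥0∞) by norm_num] at h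
    exact h
  have hfar : ∫ y, kf (x - y) * g y ≤
      (∫ z, kf z ^ (2 : ℝ)) ^ (1 / (2 : ℝ)) * (eLpNorm g 2 volume).toReal := by
    have h := integral_mul_comp_sub_le h22 hkf0 hg0 (memLp_farKernel hρ) hg2' x
    rw [rpow_integral_rpow_eq_toReal_eLpNorm (by norm_num) hg0 hg2',
      show ENNReal.ofReal 2 = (2 : ℝ≥0∞) by norm_num] at h
    exact h
  calc ∫ y, min 1 (‖x - y‖ / ρ) * (‖x - y‖ ^ 3)⁻¹ * g y
      = ∫ y, (kn (x - y) * g y + kf (x - y) * g y) := integral_congr_ae (Eventually.of_forall hsplit)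
    _ = (∫ y, kn (x - y) * g y) + ∫ y, kf (x - y) * g y := integral_add hin hif
    _ ≤ _ := add_le_add hnear hfar

end Literature.Analysis.FluidPDE

end
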